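import Literature.MathematicalPhysics.QuantumLattice.GrassmannGramBoundedLineExtraction
import HarnessLib

/-!
# Weight-type closures of replica-Gram-boundedness: Gram weights, scalings `t • C` (`t ∈ [0,1]`), indicator masks, decoupled block copies

Topic `MathematicalPhysics/QuantumLattice`; companion of `GrassmannDeterminantBounded` (`IsGramBoundedR`, `IsGramBoundedR.submatrix`) and
`GrassmannGramBoundedLineExtraction` (`isGramBounded_gramWeighted`: Gram weights of norm `≤ 1` keep the constant).  Property-level algebra — no Gram
vectors — for the covariances met in interpolations and in the nested two-volume comparison (Benfatto–Giuliani–Mastropietro 2006, (2.67)/(2.80):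
every interpolated covariance `t_{ii′} C` with `t = u·u′`, `|u| ≤ 1`, obeys the same Gram bound):

* `gramWeighted_submatrix` — pull-backs commute with Gram weights; **`isGramBoundedR_gramWeighted`** — replica-stable version of `isGramBounded_gramWeighted`;
* **`isGramBoundedR_real_smul`** — `t • C`, `0 ≤ t ≤ 1` (weight `√t` on one axis);
* **`isGramBoundedR_mask`** — `1_{Z×Z} · C` for a set of labels `Z` (indicator weights);
* **`isGramBoundedR_blockCopies`** — `X′ Y′ ↦ [blk X′ = blk Y′] · C (π X′) (π Y′)` (orthonormal block weights after the pull-back along `π`): the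
  decoupled copies of a coarse covariance inside a fine torus keep its constant (property-level twin of
  `GrassmannGramFormAlgebra.isGramBoundedR_blockCopies_of_gram`).

Everything is proved; no definition, no named fact.

## Sources
G. Benfatto, A. Giuliani, V. Mastropietro, Ann. Henri Poincaré 7 (2006) 809–898, (2.67), (2.80) [`BenfattoGiulianiMastropietro2006`];
W. de Siqueira Pedra, M. Salmhofer, Comm. Math. Phys. 282 (2008) 797–818, Thm 1.3 [`PedraSalmhofer2008`].
-/

noncomputable section

namespace Literature.MathematicalPhysics.QuantumLattice

open GrassmannAlgebra Finset
open scoped InnerProductSpace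

universe u

variable {𝕜 : Type*} [RCLike 𝕜] {Γ : Type u}

/-- Pull-backs commute with Gram weights: `(gramWeighted U C).submatrix e e = gramWeighted (U ∘ e) (C.submatrix e e)`.
[cite: BenfattoGiulianiMastropietro2006, (2.67)] -/
theorem gramWeighted_submatrix {Γ' : Type*} {n : ℕ} (U : Γ → EuclideanSpace ℝ (Fin n)) (C : Matrix Γ Γ 𝕜) (e : Γ' → Γ) :
    (gramWeighted U C).submatrix e e = gramWeighted (U ∘ e) (C.submatrix e e) := by
  ext X Y
  simp [gramWeighted_apply]

/-- **Gram weights of norm `≤ 1` keep replica-Gram-boundedness** with the same constant. [cite: BenfattoGiulianiMastropietro2006, (2.80)] -/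
theorem isGramBoundedR_gramWeighted {C : Matrix Γ Γ 𝕜} {κ : ℝ} (h : IsGramBoundedR C κ) {n : ℕ} (U : Γ → EuclideanSpace ℝ (Fin n))
    (hU : ∀ X, ‖U X‖ ≤ 1) : IsGramBoundedR (gramWeighted U C) κ := by
  intro Γ' _ _ e
  rw [gramWeighted_submatrix]
  exact isGramBounded_gramWeighted (h e) (U ∘ e) fun X => hU (e X)

/-- **`t • C` (`0 ≤ t ≤ 1`) is replica-Gram-bounded with the same constant** (the straight Duhamel path `t ↦ t • D`; weight `√t·e₀` on every label).
[cite: BenfattoGiulianiMastropietro2006, (2.67)] -/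
theorem isGramBoundedR_real_smul {C : Matrix Γ Γ 𝕜} {κ : ℝ} (h : IsGramBoundedR C κ) {t : ℝ} (ht0 : 0 ≤ t) (ht1 : t ≤ 1) :
    IsGramBoundedR (t • C) κ := by
  have hU : ∀ X : Γ, ‖(fun _ : Γ => EuclideanSpace.single (0 : Fin 1) (Real.sqrt t)) X‖ ≤ 1 := fun X => by
    have h1 : ‖(EuclideanSpace.single (0 : Fin 1) (Real.sqrt t) : EuclideanSpace ℝ (Fin 1))‖ = |Real.sqrt t| := by simp
    dsimp only
    rw [h1, abs_of_nonneg (Real.sqrt_nonneg _)]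
    exact Real.sqrt_le_one.2 ht1
  have heq : t • C = gramWeighted (fun _ : Γ => EuclideanSpace.single (0 : Fin 1) (Real.sqrt t)) C := by
    ext X Y
    rw [Matrix.smul_apply, gramWeighted_apply, EuclideanSpace.inner_single_left]
    simp only [PiLp.single_apply, if_true, conj_trivial, Real.mul_self_sqrt ht0]
    rw [RCLike.real_smul_eq_coe_mul]
  rw [heq]
  exact isGramBoundedR_gramWeighted h _ hU

/-- **Indicator masks keep replica-Gram-boundedness**: `X Y ↦ [X ∈ Z ∧ Y ∈ Z] · C X Y` has the same constant (weights `1_Z(X)·e₀`).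
[cite: BenfattoGiulianiMastropietro2006, (2.67)] -/
theorem isGramBoundedR_mask {C : Matrix Γ Γ 𝕜} {κ : ℝ} (h : IsGramBoundedR C κ) (Z : Set Γ) [DecidablePred (· ∈ Z)]
    (D : Matrix Γ Γ 𝕜) (hD : ∀ X Y, D X Y = if X ∈ Z ∧ Y ∈ Z then C X Y else 0) : IsGramBoundedR D κ := by
  have hU : ∀ X : Γ, ‖(fun X : Γ => if X ∈ Z then EuclideanSpace.single (0 : Fin 1) (1 : ℝ) else 0) X‖ ≤ 1 := fun X => by
    dsimp only
    split_ifs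
    · simp
    · rw [norm_zero]; exact zero_le_one
  have heq : D = gramWeighted (fun X : Γ => if X ∈ Z then EuclideanSpace.single (0 : Fin 1) (1 : ℝ) else 0) C := by
    ext X Y
    rw [hD, gramWeighted_apply]
    by_cases hX : X ∈ Z <;> by_cases hY : Y ∈ Z <;> simp [hX, hY]
  rw [heq]
  exact isGramBoundedR_gramWeighted h _ hU

/-- **DECOUPLED BLOCK COPIES KEEP THE CONSTANT (property level)**: for a block map `blk : Γ′ → ι` (finite `ι`) and a projection `π : Γ′ → Γ`,
`X′ Y′ ↦ [blk X′ = blk Y′] · C (π X′) (π Y′)` is replica-Gram-bounded with the constant of `C` (orthonormal block weights `e_{blk X′}` on the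
pull-back `C.submatrix π π`). [cite: BenfattoGiulianiMastropietro2006, (2.80)] -/
theorem isGramBoundedR_blockCopies {C : Matrix Γ Γ 𝕜} {κ : ℝ} (h : IsGramBoundedR C κ) {Γ' : Type u} [Fintype Γ'] [DecidableEq Γ']
    {ι : Type*} [Fintype ι] [DecidableEq ι] (blk : Γ' → ι) (π : Γ' → Γ) (C' : Matrix Γ' Γ' 𝕜)
    (hC' : ∀ X' Y', C' X' Y' = if blk X' = blk Y' then C (π X') (π Y') else 0) : IsGramBoundedR C' κ := by
  set U : Γ' → EuclideanSpace ℝ (Fin (Fintype.card ι)) := fun X' => EuclideanSpace.single (Fintype.equivFin ι (blk X')) (1 : ℝ) with hUdef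
  have hU : ∀ X', ‖U X'‖ ≤ 1 := fun X' => by simp [hUdef]
  have heq : C' = gramWeighted U (C.submatrix π π) := by
    ext X' Y'
    rw [hC', gramWeighted_apply, Matrix.submatrix_apply, hUdef, EuclideanSpace.inner_single_left]
    simp only [PiLp.single_apply]
    by_cases hb : blk X' = blk Y'
    · rw [if_pos hb, if_pos (by rw [hb])]; simp
    · rw [if_neg hb, if_neg (fun h' => hb ((Fintype.equivFin ι).injective h'))]; simp
  rw [heq]
  exact isGramBoundedR_gramWeighted (h.submatrix π) U hU

end Literature.MathematicalPhysics.QuantumLattice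

end
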